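import Summits.Ventures.PercRepro.Defs
import Summits.Ventures.PercRepro.Graph

/-!
# Configurations of minimum size, clusters, and the attachment edge

Tools for the combinatorial core of the strictness theorem of the pair-sum inequality
(`Summits.Ventures.PercRepro.PairSumStrict`), stated without any path or tree theory:

* `exists_minimal_config`: a property of configurations that holds somewhere holds at a
  configuration of minimum size, where closing any open edge destroys it;
* cluster bookkeeping: `conn_of_cluster_edges_open` (an open connection survives in any
  configuration keeping the open edges touching the cluster), `exists_open_edge_of_conn`,
  `restrictTo` (restriction to the edges with both endpoints in a vertex set),
  `conn_restrictTo_cluster`;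
* `conn_endpoints_of_minimal`, `exists_minimal_conn`: a minimal configuration with `u ↔ v` has all
  its open edges inside the cluster of `u`;
* `exists_attach_edge`: a minimal configuration joining `c` to a vertex set `W ∌ c` has an "attachment
  edge" `e = {v, w}`, `w ∈ W`, such that after closing `e` the vertex `c` is still connected to `v`
  but to no vertex of `W`;
* `closed_boundary_sup_restrict`, `no_open_edge_sup_restrict`: clusters of a union of two restricted
  configurations with disjoint vertex supports.
-/

namespace PercRepro

open Finset

variable {E : Type*}

/-! ### Configurations of minimum size -/

section Minimal

variable [Fintype E] [DecidableEq E]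

/-- Closing an open edge removes exactly one open edge. -/
theorem openEdges_update_false (ω : Config E) (e : E) :
    openEdges (Function.update ω e false) = (openEdges ω).erase e := by
  ext e'
  by_cases h : e' = e
  · subst h
    simp
  · simp [h]

/-- Among the configurations satisfying a (nonempty) property there is one of minimum size; it is
minimal in the sense that closing any of its open edges destroys the property. -/
theorem exists_minimal_config (Φ : Config E → Prop) (h : ∃ ω, Φ ω) :
    ∃ ω, Φ ω ∧ ∀ e, ω e = true → ¬ Φ (Function.update ω e false) := by
  classical
  obtain ⟨ω₀, hω₀⟩ := h
  obtain ⟨ω, hω, hmin⟩ := Finset.exists_min_image (univ.filter Φ) (fun ω => (openEdges ω).card)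
    ⟨ω₀, by simpa using hω₀⟩
  refine ⟨ω, by simpa using hω, fun e he hΦ => ?_⟩
  have h1 := hmin (Function.update ω e false) (by simpa using hΦ)
  rw [openEdges_update_false] at h1
  have h2 : ((openEdges ω).erase e).card < (openEdges ω).card :=
    Finset.card_erase_lt_of_mem (by simpa using he)
  omega

end Minimal

/-! ### Cluster bookkeeping -/

namespace MultiGraph

variable {V : Type*} {G : MultiGraph V E}

/-- An open connection `u ↔ v` of `ω` survives in any `ω'` that keeps every open edge of `ω`
touching the open cluster of `u`. -/
theorem conn_of_cluster_edges_open {ω ω' : Config E} {u : V}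
    (h : ∀ e, ω e = true → G.Conn ω u (G.fst e) → ω' e = true) {v : V} (huv : G.Conn ω u v) :
    G.Conn ω' u v := by
  refine Conn.induction (motive := fun v => G.Conn ω' u v) (Conn.refl G ω' u) ?_ huv
  intro x y hux hxy ih
  obtain ⟨e, he, hend⟩ := hxy
  have hfst : G.Conn ω u (G.fst e) := by
    rcases hend with ⟨rfl, _⟩ | ⟨_, rfl⟩
    · exact hux
    · exact hux.trans (Conn.of_openAdj ⟨e, he, Or.inr ⟨rfl, rfl⟩⟩)
  exact ih.trans (Conn.of_openAdj ⟨e, h e he hfst, hend⟩)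

/-- A vertex with no open edge is isolated: it is connected only to itself. -/
theorem conn_eq_of_no_open_edge {ω : Config E} {v : V}
    (hv : ∀ e, ω e = true → G.fst e ≠ v ∧ G.snd e ≠ v) {u : V} (h : G.Conn ω u v) : u = v :=
  (eq_of_conn_of_isolated hv h.symm)

/-- A connected vertex different from `v` has an open edge at `v`. -/
theorem exists_open_edge_of_conn {ω : Config E} {u v : V} (h : G.Conn ω v u) (huv : u ≠ v) :
    ∃ e, ω e = true ∧ (G.fst e = v ∨ G.snd e = v) := by
  by_contra hcon
  refine huv (eq_of_conn_of_isolated (fun e he => ?_) h)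
  by_contra h'
  exact hcon ⟨e, he, by
    rcases not_and_or.1 h' with h1 | h1
    · exact Or.inl (not_not.1 h1)
    · exact Or.inr (not_not.1 h1)⟩

open Classical in
/-- Restricting a configuration to the edges with both endpoints in a vertex set `X`. -/
noncomputable def restrictTo (G : MultiGraph V E) (ω : Config E) (X : Set V) : Config E :=
  fun e => ω e && decide (G.fst e ∈ X ∧ G.snd e ∈ X)

/-- Restriction to a vertex set is pointwise below the configuration. -/
theorem restrictTo_le (ω : Config E) (X : Set V) : G.restrictTo ω X ≤ ω := fun e => by
  simp only [restrictTo]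
  cases ω e <;> simp

/-- An edge is open in the restriction iff it is open and both endpoints lie in `X`. -/
theorem restrictTo_eq_true_iff {ω : Config E} {X : Set V} {e : E} :
    G.restrictTo ω X e = true ↔ ω e = true ∧ G.fst e ∈ X ∧ G.snd e ∈ X := by
  simp [restrictTo]

/-- Restricting to the open cluster of `u` keeps all connections from `u`. -/
theorem conn_restrictTo_cluster {ω : Config E} {u v : V} (h : G.Conn ω u v) :
    G.Conn (G.restrictTo ω (G.cluster ω u)) u v := by
  refine conn_of_cluster_edges_open (fun e he hfst => ?_) h
  rw [restrictTo_eq_true_iff]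
  exact ⟨he, hfst, hfst.trans (Conn.of_openAdj (G.openAdj_of_open e he))⟩


/-! ### Minimal connecting configurations -/

section MinimalConn

variable [Fintype E] [DecidableEq E]

omit [Fintype E] in
/-- In a configuration of minimum size connecting `u` to `v`, every open edge has both endpoints
in the open cluster of `u`. -/
theorem conn_endpoints_of_minimal {P : Config E} {u v : V} (h1 : G.Conn P u v)
    (hmin : ∀ g, P g = true → ¬ G.Conn (Function.update P g false) u v) {g : E}
    (hg : P g = true) : G.Conn P u (G.fst g) ∧ G.Conn P u (G.snd g) := by
  have hP : P = Function.update (Function.update P g false) g true := by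
    rw [Function.update_idem]
    exact (Function.update_eq_self_iff.2 hg.symm).symm
  have hadj : G.Conn P (G.fst g) (G.snd g) := Conn.of_openAdj (G.openAdj_of_open g hg)
  have h1' := h1
  rw [hP, conn_update_true_iff] at h1'
  rcases h1' with h | ⟨h, _⟩ | ⟨h, _⟩
  · exact absurd h (hmin g hg)
  · have h' := h.mono (update_false_le P g)
    exact ⟨h', h'.trans hadj⟩
  · have h' := h.mono (update_false_le P g)
    exact ⟨h'.trans hadj.symm, h'⟩

/-- A configuration of minimum size with `u ↔ v` and `u ↮ x`. -/
theorem exists_minimal_conn {u v x : V} (h : ∃ ω, G.Conn ω u v ∧ ¬ G.Conn ω u x) :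
    ∃ P : Config E, G.Conn P u v ∧ ¬ G.Conn P u x ∧
      ∀ g, P g = true → ¬ G.Conn (Function.update P g false) u v := by
  obtain ⟨P, ⟨h1, h2⟩, hmin⟩ :=
    exists_minimal_config (fun ω => G.Conn ω u v ∧ ¬ G.Conn ω u x) h
  exact ⟨P, h1, h2, fun g hg hcon =>
    hmin g hg ⟨hcon, fun h' => h2 (h'.mono (update_false_le P g))⟩⟩

end MinimalConn

/-! ### The attachment edge -/

section Attach

variable [Fintype E] [DecidableEq E]

/-- **The attachment lemma.**  Let `W` be a set of vertices not containing `c` and suppose some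
configuration joins `c` to a vertex of `W`.  A configuration `Q` of minimum size doing so has an
open edge `e = {v, w}` with `w ∈ W`, such that in `Q' = Q[e := false]`: `c ↔ v`, and no vertex of
`W` is connected to `c`. -/
theorem exists_attach_edge {W : Set V} {c : V} (hcW : c ∉ W)
    (h : ∃ ω : Config E, ∃ y ∈ W, G.Conn ω c y) :
    ∃ (Q : Config E) (e : E) (v w : V), Q e = true ∧ w ∈ W ∧
      ((G.fst e = v ∧ G.snd e = w) ∨ (G.fst e = w ∧ G.snd e = v)) ∧
      G.Conn (Function.update Q e false) c v ∧
      ∀ y, G.Conn (Function.update Q e false) c y → y ∉ W := by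
  obtain ⟨Q, ⟨w, hwW, hcw⟩, hmin⟩ :=
    exists_minimal_config (fun ω : Config E => ∃ y ∈ W, G.Conn ω c y) h
  have hcw' : c ≠ w := fun h' => hcW (h' ▸ hwW)
  obtain ⟨e, he, hend⟩ := exists_open_edge_of_conn hcw.symm hcw'
  have hnot : ∀ y, G.Conn (Function.update Q e false) c y → y ∉ W :=
    fun y hy hyW => hmin e he ⟨y, hyW, hy⟩
  have hQ : Q = Function.update (Function.update Q e false) e true := by
    rw [Function.update_idem]
    exact (Function.update_eq_self_iff.2 he.symm).symm
  have hcw2 := hcw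
  rw [hQ, conn_update_true_iff] at hcw2
  rcases hcw2 with h1 | ⟨h1, _⟩ | ⟨h1, _⟩
  · exact absurd hwW (hnot w h1)
  · -- `c ↔ fst e` in `Q'`; then `fst e ≠ w`, so `snd e = w`
    rcases hend with hfe | hse
    · exact absurd hwW (hnot w (hfe ▸ h1))
    · exact ⟨Q, e, G.fst e, w, he, hwW, Or.inl ⟨rfl, hse⟩, h1, hnot⟩
  · rcases hend with hfe | hse
    · exact ⟨Q, e, G.snd e, w, he, hwW, Or.inr ⟨hfe, rfl⟩, h1, hnot⟩
    · exact absurd hwW (hnot w (hse ▸ h1))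

end Attach

/-! ### Clusters of a union of two restricted configurations -/

section Union

variable [DecidableEq E]

omit [DecidableEq E] in
/-- Open edges of a pointwise supremum. -/
theorem sup_apply_eq_true_iff (ω ω' : Config E) (e : E) :
    (ω ⊔ ω') e = true ↔ ω e = true ∨ ω' e = true := by
  simp [Pi.sup_apply]

omit [DecidableEq E] in
/-- If `ω = restrictTo ω₁ X ⊔ restrictTo ω₂ Y` with `X ∩ Y = ∅`, then `X` has a closed boundary
in `ω`. -/
theorem closed_boundary_sup_restrict (ω₁ ω₂ : Config E) {X Y : Set V} (hXY : Disjoint X Y)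
    (e : E) (he : (G.restrictTo ω₁ X ⊔ G.restrictTo ω₂ Y) e = true) :
    (G.fst e ∈ X ↔ G.snd e ∈ X) := by
  rw [sup_apply_eq_true_iff, restrictTo_eq_true_iff, restrictTo_eq_true_iff] at he
  rcases he with ⟨_, h1, h2⟩ | ⟨_, h1, h2⟩
  · exact ⟨fun _ => h2, fun _ => h1⟩
  · exact ⟨fun h => absurd h (Set.disjoint_right.1 hXY h1),
      fun h => absurd h (Set.disjoint_right.1 hXY h2)⟩

omit [DecidableEq E] in
/-- A vertex in neither `X` nor `Y` has no open edge in `restrictTo ω₁ X ⊔ restrictTo ω₂ Y`. -/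
theorem no_open_edge_sup_restrict (ω₁ ω₂ : Config E) {X Y : Set V} {z : V} (hzX : z ∉ X)
    (hzY : z ∉ Y) (e : E) (he : (G.restrictTo ω₁ X ⊔ G.restrictTo ω₂ Y) e = true) :
    G.fst e ≠ z ∧ G.snd e ≠ z := by
  rw [sup_apply_eq_true_iff, restrictTo_eq_true_iff, restrictTo_eq_true_iff] at he
  rcases he with ⟨_, h1, h2⟩ | ⟨_, h1, h2⟩
  · exact ⟨fun h => hzX (h ▸ h1), fun h => hzX (h ▸ h2)⟩
  · exact ⟨fun h => hzY (h ▸ h1), fun h => hzY (h ▸ h2)⟩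

/-- The same, for `restrictTo ω₁ X ⊔ restrictTo ω₂ Y` with one more edge `e` opened, provided the
endpoints of `e` are not `z`. -/
theorem no_open_edge_sup_restrict_update (ω₁ ω₂ : Config E) {X Y : Set V} {z : V} (hzX : z ∉ X)
    (hzY : z ∉ Y) {e : E} (hfe : G.fst e ≠ z) (hse : G.snd e ≠ z) (g : E)
    (hg : Function.update (G.restrictTo ω₁ X ⊔ G.restrictTo ω₂ Y) e true g = true) :
    G.fst g ≠ z ∧ G.snd g ≠ z := by
  by_cases hge : g = e
  · subst hge
    exact ⟨hfe, hse⟩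
  · rw [Function.update_of_ne hge] at hg
    exact no_open_edge_sup_restrict ω₁ ω₂ hzX hzY g hg

end Union

end MultiGraph

end PercRepro
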